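import Summits.Ventures.Crystal3D.Theorems.StickyWulffConstantCoaxialWallLawForeignTilt
import Summits.Ventures.Crystal3D.Theorems.StickyWulffConstantGenericWallFloorStepGain
import HarnessLib

/-!
# The two `{111}` normals through a capper direction: equal or mirror images

HONEST FRAMING. Part of the venture `Summits/Ventures/Crystal3D` (cell `crystal3d-full`), helper
`--supports` the crux `GenericWallFloor` (stmt-Ventures-19480) of `route-Ventures-StickyWulffConstant`,
registered line `WallLedgerG`, open stub `stub_twoSlabAdhesion` (general fillings).  Brick of the STACK WALK
ledger (with `…CapperRiseSharp`): the walker that has just crossed an exact twin cap with normal `n` travels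
along a capper direction `c` (`⟪c, n⟫ = √(2/3)`); if it meets another exact cap, with normal `n′` and
`⟪c, n′⟫ = √(2/3)`, then `n′ = n` (the lamella closes) or `n′ = 2√(2/3) c − n` (the twin of the twin), so the
height bound `⟪n′, z⟫ ≥ 1/7` is inherited from `best_capper_bounds`.

* (from `…CoaxialWallLawForeignTilt`, 19481 lane: `inner_menu_normals` — two unit menu normals of one
  frame have inner product `1, −1, 1/3` or `−1/3`.)
* **`menu_normal_eq_or_eq_twin`** — if both make the same unit vector `c` positive at the menu value
  `√(2/3)`, they are equal or mirror images: `n′ = n ∨ n′ = (2√(2/3)) • c − n`.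
* `menu_reflect` — a menu normal `n` of `G` is a menu normal of the twin frame `x ↦ G x − 2⟪G x, n⟫ n`.

WHAT THIS IS NOT: not the stub; pure slot geometry; F-C1 not moved.
-/

noncomputable section

namespace Summit.Ventures.Crystal3D.Theorems

open scoped InnerProductSpace

/-- **The two `{111}` normals through a capper.**  Two unit menu normals `n, n′` of one frame with
`⟪c, n⟫ = ⟪c, n′⟫ = √(2/3)` for a unit vector `c` coincide or are mirror images through `c`:
`n′ = n` or `n′ = 2√(2/3) c − n`. -/
theorem menu_normal_eq_or_eq_twin (G : EuclideanSpace ℝ (Fin 3) ≃ₗᵢ[ℝ] EuclideanSpace ℝ (Fin 3))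
    {n n' c : EuclideanSpace ℝ (Fin 3)} (hn : ‖n‖ = 1) (hn' : ‖n'‖ = 1) (hc : ‖c‖ = 1)
    (hmenu : ∀ w ∈ fccSlots, ⟪G w, n⟫_ℝ = 0 ∨ ⟪G w, n⟫_ℝ = Real.sqrt (2 / 3) ∨ ⟪G w, n⟫_ℝ = -Real.sqrt (2 / 3))
    (hmenu' : ∀ w ∈ fccSlots, ⟪G w, n'⟫_ℝ = 0 ∨ ⟪G w, n'⟫_ℝ = Real.sqrt (2 / 3) ∨ ⟪G w, n'⟫_ℝ = -Real.sqrt (2 / 3))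
    (hcn : ⟪c, n⟫_ℝ = Real.sqrt (2 / 3)) (hcn' : ⟪c, n'⟫_ℝ = Real.sqrt (2 / 3)) :
    n' = n ∨ n' = (2 * Real.sqrt (2 / 3)) • c - n := by
  obtain ⟨hd2, -⟩ := sqrt_twoThirds_facts
  have nn : ⟪n, n⟫_ℝ = 1 := by rw [real_inner_self_eq_norm_sq, hn, one_pow]
  have n'n' : ⟪n', n'⟫_ℝ = 1 := by rw [real_inner_self_eq_norm_sq, hn', one_pow]
  have cc : ⟪c, c⟫_ℝ = 1 := by rw [real_inner_self_eq_norm_sq, hc, one_pow]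
  have hnc : ⟪n, c⟫_ℝ = Real.sqrt (2 / 3) := by rw [real_inner_comm, hcn]
  have hn'c : ⟪n', c⟫_ℝ = Real.sqrt (2 / 3) := by rw [real_inner_comm, hcn']
  -- Cauchy–Schwarz on `n + n′` against `c`: `⟪n, n′⟫ ≥ 1/3`
  have hCS := real_inner_mul_inner_self_le (n + n') c
  have hsum : ⟪n + n', c⟫_ℝ = 2 * Real.sqrt (2 / 3) := by rw [inner_add_left, hnc, hn'c]; ring
  have hpp : ⟪n + n', n + n'⟫_ℝ = 2 + 2 * ⟪n, n'⟫_ℝ := by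
    rw [inner_add_left, inner_add_right, inner_add_right, nn, n'n', real_inner_comm n n']; ring
  rw [hsum, hpp, cc] at hCS
  have hge : 1 / 3 ≤ ⟪n, n'⟫_ℝ := by nlinarith [hd2]
  rcases inner_menu_normals G hn hn' hmenu hmenu' with h | h | h | h
  · -- `⟪n, n′⟫ = 1`: equal
    left
    have : ‖n' - n‖ ^ 2 = 0 := by
      rw [← real_inner_self_eq_norm_sq, inner_sub_left, inner_sub_right, inner_sub_right, nn, n'n',
        real_inner_comm n n', h]; ring
    have : ‖n' - n‖ = 0 := by nlinarith [norm_nonneg (n' - n)]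
    exact sub_eq_zero.1 (norm_eq_zero.1 this)
  · rw [h] at hge; norm_num at hge
  · -- `⟪n, n′⟫ = 1/3`: `n + n′ = 2√(2/3) c`
    right
    have : ‖n' - ((2 * Real.sqrt (2 / 3)) • c - n)‖ ^ 2 = 0 := by
      rw [← real_inner_self_eq_norm_sq]
      simp only [inner_sub_left, inner_sub_right, inner_smul_left, inner_smul_right, nn, n'n', cc, hnc, hn'c,
        hcn, hcn', real_inner_comm n n', h, RCLike.conj_to_real]
      nlinarith [hd2]
    have : ‖n' - ((2 * Real.sqrt (2 / 3)) • c - n)‖ = 0 := by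
      nlinarith [norm_nonneg (n' - ((2 * Real.sqrt (2 / 3)) • c - n))]
    exact sub_eq_zero.1 (norm_eq_zero.1 this)
  · rw [h] at hge; norm_num at hge

/-- **The menu survives the twin reflection.**  If `n` is a unit menu normal of `G` and
`G′ x = G x − 2⟪G x, n⟫ n`, then `n` is a menu normal of `G′` (with the opposite signs). -/
theorem menu_reflect (G G' : EuclideanSpace ℝ (Fin 3) ≃ₗᵢ[ℝ] EuclideanSpace ℝ (Fin 3))
    {n : EuclideanSpace ℝ (Fin 3)} (hn : ‖n‖ = 1)
    (hmenu : ∀ w ∈ fccSlots, ⟪G w, n⟫_ℝ = 0 ∨ ⟪G w, n⟫_ℝ = Real.sqrt (2 / 3) ∨ ⟪G w, n⟫_ℝ = -Real.sqrt (2 / 3))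
    (hG' : ∀ x, G' x = G x - (2 * ⟪G x, n⟫_ℝ) • n) :
    ∀ w ∈ fccSlots, ⟪G' w, n⟫_ℝ = 0 ∨ ⟪G' w, n⟫_ℝ = Real.sqrt (2 / 3) ∨ ⟪G' w, n⟫_ℝ = -Real.sqrt (2 / 3) := by
  intro w hw
  have nn : ⟪n, n⟫_ℝ = 1 := by rw [real_inner_self_eq_norm_sq, hn, one_pow]
  have e : ⟪G' w, n⟫_ℝ = -⟪G w, n⟫_ℝ := by
    rw [hG', inner_sub_left, inner_smul_left, nn]; simp; ring
  rw [e]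
  rcases hmenu w hw with h | h | h
  · left; rw [h]; simp
  · right; right; rw [h]
  · right; left; rw [h]; simp

end Summit.Ventures.Crystal3D.Theorems

end
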